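import Literature.MathematicalPhysics.QuantumFieldTheory.Balaban1983to89.NodeOKernel216

/-!
# `Balaban1983to89.NodeOKernel216R` — THE (2.16)-LEVEL RECORD WITH THE COVARIANCE (AND Γ) MAJORANTS REPLACED BY THE TWO REAL
# REFERENCE LOCALISATIONS: four primitives `refΓ refC dΓ dE` + u-holomorphy; the majorants come back by the triangle inequality and a
# NEUMANN SERIES in the weighted-row-sum algebra (T. Bałaban, CMP **116** (1988) [II] = [Balaban1988RG2Cluster] (2.16) p. 16, p. 13, p. 15;
# CMP **99** (1985) [Balaban1985BackgroundPropagators] Thm 3.10 p. 416)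

statement-level skeleton of published theorems with citation tags; proofs where landed; nothing here is a claim about the Yang–Mills mass gap

CITATION HEADER (lean-in-tree rule).  Ideation cell `ym-nodeO-ideate` (portfolio track, 2026-08-25), seat P3 «weaken the target», memo
`memos/ROUTE-P3.md` v3.15 (sha256 756f0b72…) §2 row W-216R (census C43), §9 nomination **N2**.  LANDING EDITION (generation 14), module 2 of
N2, of the memo companion `memos/ROUTE-P3-SketchT21.lean` («T21c», sha256 3050ac2c…, 517 l., 0 `sorry`, 0 `axiom`; referee REF g18 PASS
2026-08-25T17:49:30Z; director-ym LINE №2 (A)∕(B)): T21c §3 :258–:434 (`Kernel216R`, `Kernel216.toR`, `Kernel216R.inv_majorant` ∕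
`gamma_majorant` ∕ **`toKernel216`**, `TermWalkDataR`, `TermWalkData.toR`, `Kernel216R.of_termWalkDataR`) and §4 :436–:508 (**`AcrossOn216R`**,
`acrossOn216R_of_acrossOn216`, `neumann_const_mono`, **`acrossOn216_of_R`**).  Statements and proofs below are CHARACTER-IDENTICAL to T21c's;
edition deltas = the namespace (`YM.NodeO.P3.T21` → this module's), this header, the import (T21c's one import is the Summits-side NE5
module `TwoRunTorusWalkParam`, which a Literature file cannot have; replaced by module 1 `NodeOKernel216`, whose chain carries every tree
declaration §3–§4 use), the opens cut to the ones used, the CUT of T21c §1 (`Kernel216` ∕ `localisation17a` ∕ `differences216` — verbatim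
copies of SK §F.1, now module 1's) and of §4's two verbatim copies `Kernel216.weaken` :443 ∕ `AcrossOn216` :459 (module 1's, reached by
`open`), the CUT of T21c §2 `hol_and_h226_torus_of_kernel216_param` (census C45: it instantiates the record INTO the Summits-side spine
`TwoRunTorusPrimitiveParam` — not importable here; it stays in the companion), ONE declaration-head rewrite forced by the split —
`theorem Kernel216.toR` is declared as `theorem _root_.….NodeOKernel216.Kernel216.toR` (same binders, statement and proof; the name must
live in `Kernel216`'s own namespace for §4's dot-notation `(hall s hs i).toR` to resolve, exactly as it did inside T21c's single namespace) —
and the companion's closing `#print axioms` lines dropped.  LABELS in the docstrings (memo-side words, NOT tree declarations): «NODE O» =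
:353 `B13TermWalkDataOneTorus.ExistsUniformAcrossSmall`; «NODE A» = `B13PrimitiveKernels216.h226_torus_of_kernelBounds`; «T18 ∕ T19 ∕ T21 ∕
T25 ∕ T31», «the spine», «`TwoRunPrimitivePencil`», «§2» = Summits-side NE5 modules ∕ the companion's cut section, named only; «SK» = the
companion `ROUTE-P3-Sketch.lean` (module 1's source); «(W-216)», «(W-216R)», «(W-216R|P)», «C43», «C45», «g1-p2» = memo row ∕ census ∕ cell
labels; «[II]» = [Balaban1988RG2Cluster]; «[B9]» ∕ «[13]» = [Balaban1985BackgroundPropagators] (reference 13 of [II]); «[B12] Thm 2» =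
[Balaban1987RG1] Thm 2 p. 259 (endpoint existence of the coupling flow — the DAG's apex side, untouched here).

PRINT STATUS (LIT `lit/SOURCES.md` §1.1 ∕ §6).  PRINTED: the two real reference localisations ([II] p. 15: the operators at the real
background; [B9] Thm 3.10 p. 416 ∕ [13] Thm 3.15 as Bałaban cites them), the located differences (2.16) p. 16, the Γ-majorant p. 13, the
distance (1.11) p. 5.  NOT PRINTED AS SUCH: the packaging `Kernel216R` and the observation `toKernel216` that, in NODE A's smallness regime,
the uniform complex majorant of the covariance is RECOVERED from the four primitives by a Neumann series (Bałaban obtains his majorants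
through the walk expansions themselves, [II] p. 13) — a format remark for Bałaban's own σ, typed here because the tree's consumers read the
record, not the walks.  Proofs: bookkeeping over the tree's `B13PerturbativeStep` (`WRS.inv_add`), `B13Bound226Located`
(`WRS_of_entrywise_loc`), `B13Lemma3TorusPrimitive`, `B13PrimitiveKernels216` (`sub_ref_le_of_analytic`) — [folklore] relative to those.

WHAT IS PROVED (sorry-free, axiom-free).
* §3 `Kernel216R 𝒦 α κ K_Γ K₀ θ_Γ θ_E` (four primitives + u-holomorphy); `Kernel216.toR` ((W-216) ⟹ (W-216R), letters kept);
  `Kernel216R.inv_majorant` (the covariance majorant `‖A(σ,u)⁻¹(b,b′)‖ ≤ (1 − Kϑ)⁻¹K e^{−κ′d₁}` by Neumann series at any dropped rate,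
  invertibility INCLUDED — no symmetry, no `Re ≻ 0`); `gamma_majorant` (triangle); **`toKernel216`** ((W-216R) ⟹ (W-216) at any
  `κ′ < κ` under `K₀·mK_c·θ_E·mK_c < 1`); walk level: `TermWalkDataR` (NODE O's `TermWalkData` with the covariance walk majorants
  replaced by `refC`), `TermWalkData.toR`, `Kernel216R.of_termWalkDataR` (E1 to the four-primitive record).
* §4 `AcrossOn216R 𝓣 P α θ₀` (common letters on a member set); `acrossOn216R_of_acrossOn216`; `neumann_const_mono`;
  **`acrossOn216_of_R`**: (W-216R|P) + a uniform ENTROPY letter `Λ₀ ≥ m·(1+2∕(κ−κ′))^ν` + `K₀Λ₀·θ_EΛ₀ < 1` ⟹ (W-216|P) (module 1's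
  `AcrossOn216`, hence NODE A's inputs by `AcrossOn216.nodeA_inputs`).

WHAT THIS IS NOT.  NOT an inhabitant of :353, of `Kernel216R` or of any socket; NOT a weakening of the σ-walk content of (v)
(`B13TermWalkData`) — the same located bounds with one expansion object fewer as an INDEPENDENT duty; NOT a change to NODE A's statement;
nothing of Bałaban's `C^{(k)}(Z₀,σ,u)`, `Γ_k(Z₀,σ)` is constructed or asserted; no YM-PLAN ∕ Track-B node is claimed closed and no Track-B
number is produced; not continuum, not mass gap, not Clay.  NEW file, imports built tree modules only; nothing modified.  Dimension-generic.
Net new unproved facts: 0.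
[cite: Balaban1988RG2Cluster, (2.16) p.16, p.13, p.15, (1.11) p.5; Balaban1985BackgroundPropagators, Thm 3.10 p.416] -/

noncomputable section

open Matrix Metric Set Finset

namespace Literature.MathematicalPhysics.QuantumFieldTheory.Balaban1983to89.NodeOKernel216R

open Literature.MathematicalPhysics.QuantumFieldTheory.Balaban1983to89.NodeOKernel216
open Literature.MathematicalPhysics.QuantumFieldTheory.Balaban1983to89.TreeLengthTorus (TPt)
open Literature.MathematicalPhysics.QuantumFieldTheory.Balaban1983to89.B5TorusCover (UT)
open Literature.MathematicalPhysics.QuantumFieldTheory.Balaban1983to89.B9Thm37GlueTorus (tdist1 tdist1_nonneg)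
open Literature.MathematicalPhysics.QuantumFieldTheory.Balaban1983to89.B13PrimitiveKernels216
open Literature.MathematicalPhysics.QuantumFieldTheory.Balaban1983to89.B13TermWalkData
open Literature.MathematicalPhysics.QuantumFieldTheory.Balaban1983to89.B13TermWalkDataOneTorus
open Literature.MathematicalPhysics.QuantumFieldTheory.Balaban1983to89.B13JointWalkExpansion (JointWalkExpansion)
open Literature.MathematicalPhysics.QuantumFieldTheory.Balaban1983to89.B13PerturbativeStep (WRS WeightHyp)
open Literature.MathematicalPhysics.QuantumFieldTheory.Balaban1983to89.B13Bound226Located (WRS_of_entrywise_loc weightHyp_loc)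
open Literature.MathematicalPhysics.QuantumFieldTheory.Balaban1983to89.B13Lemma3TorusPrimitive (weightHyp_tdist1 kc_tdist1)

/-! ## §3  (C43) THE RECORD WITH THE COVARIANCE (AND Γ) MAJORANTS REPLACED BY REAL REFERENCE LOCALISATIONS -/

section FourPrimitives

variable {d : ℕ} {c : B13.Consts} {N' ν : ℕ} {Nf : Fin ν → ℕ} [∀ i, NeZero (Nf i)]
variable {E : Type*} [NormedAddCommGroup E] [NormedSpace ℂ E]

/-- (W-216R, ONE TERM) **THE FOUR-PRIMITIVE RECORD**: the two REAL REFERENCE localisations `‖Γ₀(b,j)‖ ≤ K_Γe^{−κd₁}`,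
`‖C(b,b′)‖ ≤ K₀e^{−κd₁}` (operators at `(σ,u) = (0,0)`, real background, positive measure — [II] p.15; [B9] Thm 3.10 ∕ [13] as
printed), the two located COMPLEX differences (2.16) `G(σ,u) − Γ₀`, `A(σ,u) − C⁻¹` on polydisc × {‖u‖ ≤ α}, and u-holomorphy of
the entries on the open `α`-ball.  NO uniform complex majorant of the Γ-kernel, NONE of the covariance `A(σ,u)⁻¹`.
[cite: Balaban1988RG2Cluster, (2.16) p.16, p.15, p.13; Balaban1985BackgroundPropagators, Thm 3.10 p.416] -/
structure Kernel216R (𝒦 : TermKernels c d N' ν Nf E) (α kap KΓ K₀ θΓ θE : ℝ) : Prop where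
  refΓ : ∀ b j, ‖𝒦.Γ₀ b j‖ ≤ KΓ * Real.exp (-(kap * tdist1 Nf (𝒦.locΛ b) (𝒦.locN j)))
  refC : ∀ b b', ‖𝒦.C b b'‖ ≤ K₀ * Real.exp (-(kap * tdist1 Nf (𝒦.locΛ b) (𝒦.locΛ b')))
  dΓ : ∀ σ : TPt d N' → ℂ, (∀ j, ‖σ j‖ ≤ Real.exp c.κ₁) → ∀ u : E, ‖u‖ ≤ α →
    ∀ b j, ‖(𝒦.G2 σ u - 𝒦.Γ₀.map (algebraMap ℝ ℂ)) b j‖ ≤ θΓ * Real.exp (-(kap * tdist1 Nf (𝒦.locΛ b) (𝒦.locN j)))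
  dE : ∀ σ : TPt d N' → ℂ, (∀ j, ‖σ j‖ ≤ Real.exp c.κ₁) → ∀ u : E, ‖u‖ ≤ α →
    ∀ b b', ‖(𝒦.A2 σ u - 𝒦.C⁻¹.map (algebraMap ℝ ℂ)) b b'‖ ≤ θE * Real.exp (-(kap * tdist1 Nf (𝒦.locΛ b) (𝒦.locΛ b')))
  holE : JointWalkExpansion.AnalyticOnBall c 𝒦.A2 α
  holΓ : JointWalkExpansion.AnalyticOnBall c 𝒦.G2 α

/-- (W-216) ⟹ (W-216R), letters kept (`K_Γ := K_G`, `K₀ := K_Cs`): the reference localisations are the majorants at `(0,0)`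
through `G(0,0) = Γ₀`, `A(0,0)⁻¹ = C`. [cite: Balaban1988RG2Cluster, p.15] -/
theorem _root_.Literature.MathematicalPhysics.QuantumFieldTheory.Balaban1983to89.NodeOKernel216.Kernel216.toR
    {𝒦 : TermKernels c d N' ν Nf E} {α kap KG KCs θΓ θE : ℝ} (h : Kernel216 𝒦 α kap KG KCs θΓ θE)
    (hα : 0 ≤ α) : Kernel216R 𝒦 α kap KG KCs θΓ θE :=
  have h17 := h.localisation17a hα (u := 0) (by rw [norm_zero]; exact hα)
  ⟨h17.hΓ₀, h17.hC216, h.dΓ, h.dE, h.holE, h.holΓ⟩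

namespace Kernel216R

variable {𝒦 : TermKernels c d N' ν Nf E} {α kap KΓ K₀ θΓ θE : ℝ}

/-- **THE COVARIANCE MAJORANT BY NEUMANN SERIES** (no walk expansion of `A(σ,u)⁻¹`, no symmetry, no `Re ≻ 0`): with
`M₀ := C⁻¹` (a unit, `M₀⁻¹ = C` localised with `K₀` at rate `κ`) and `R := A(σ,u) − C⁻¹` ((2.16) with `θ_E` at rate `κ`), at
any dropped rate `0 ≤ κ′ < κ` the weighted-row-sum constants are `K = K₀·mK_c(κ−κ′)`, `ϑ = θ_E·mK_c(κ−κ′)`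
(`B13Bound226Located.WRS_of_entrywise_loc`, any fibre bound `m ≥ 𝒦.m`), and `Kϑ < 1` gives `A(σ,u) = M₀ + R` invertible with
`‖A(σ,u)⁻¹(b,b′)‖ ≤ (1 − Kϑ)⁻¹K·e^{−κ′d₁}` (`B13PerturbativeStep.WRS.inv_add`). [cite: Balaban1988RG2Cluster, (2.16) p.16] -/
theorem inv_majorant (h : Kernel216R 𝒦 α kap KΓ K₀ θΓ θE) (hK₀ : 0 ≤ K₀) (hθE : 0 ≤ θE)
    {m : ℕ} (hm : 𝒦.m ≤ m) {kap' : ℝ} (hkap' : 0 ≤ kap') (hlt : kap' < kap)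
    (hsmall : K₀ * (m * (1 + 2 / (kap - kap')) ^ ν) * (θE * (m * (1 + 2 / (kap - kap')) ^ ν)) < 1)
    (σ : TPt d N' → ℂ) (hσ : ∀ j, ‖σ j‖ ≤ Real.exp c.κ₁) (u : E) (hu : ‖u‖ ≤ α) :
    IsUnit (𝒦.A2 σ u) ∧
      ∀ b b', ‖(𝒦.A2 σ u)⁻¹ b b'‖ ≤
        (1 - K₀ * (m * (1 + 2 / (kap - kap')) ^ ν) * (θE * (m * (1 + 2 / (kap - kap')) ^ ν)))⁻¹
          * (K₀ * (m * (1 + 2 / (kap - kap')) ^ ν)) * Real.exp (-(kap' * tdist1 Nf (𝒦.locΛ b) (𝒦.locΛ b'))) := by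
  -- the complexified reference precision `M₀ = C⁻¹` is a unit with inverse `C`
  have hCu : IsUnit 𝒦.C.det := 𝒦.hC.det_pos.ne'.isUnit
  have hmul : 𝒦.C⁻¹.map (algebraMap ℝ ℂ) * 𝒦.C.map (algebraMap ℝ ℂ) = 1 := by
    rw [← Matrix.map_mul, Matrix.nonsing_inv_mul 𝒦.C hCu, Matrix.map_one _ (map_zero _) (map_one _)]
  have hinv : (𝒦.C⁻¹.map (algebraMap ℝ ℂ))⁻¹ = 𝒦.C.map (algebraMap ℝ ℂ) := Matrix.inv_eq_right_inv hmul
  have hM : IsUnit (𝒦.C⁻¹.map (algebraMap ℝ ℂ)) :=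
    (Matrix.isUnit_iff_isUnit_det _).2 (Matrix.isUnit_det_of_right_inverse hmul)
  have hfib : ∀ x : UT Nf, (Finset.univ.filter fun i => 𝒦.locΛ i = x).card ≤ m := fun x => (𝒦.hfib x).trans hm
  have hw : WeightHyp kap' (fun i j : 𝒦.Λ => tdist1 Nf (𝒦.locΛ i) (𝒦.locΛ j)) :=
    weightHyp_loc weightHyp_tdist1 hkap' 𝒦.locΛ
  -- WRS constants of `M₀⁻¹ = C` and of the perturbation `R = A(σ,u) − C⁻¹` at the dropped rate
  have hK : WRS kap' (fun i j : 𝒦.Λ => tdist1 Nf (𝒦.locΛ i) (𝒦.locΛ j)) (𝒦.C⁻¹.map (algebraMap ℝ ℂ))⁻¹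
      (K₀ * (m * (1 + 2 / (kap - kap')) ^ ν)) :=
    WRS_of_entrywise_loc (Kc := fun b : ℝ => (1 + 2 / b) ^ ν) kc_tdist1 hK₀ hlt 𝒦.locΛ hfib fun i j => by
      rw [hinv, Matrix.map_apply, Complex.coe_algebraMap, Complex.norm_real]; exact h.refC i j
  have hR : WRS kap' (fun i j : 𝒦.Λ => tdist1 Nf (𝒦.locΛ i) (𝒦.locΛ j)) (𝒦.A2 σ u - 𝒦.C⁻¹.map (algebraMap ℝ ℂ))
      (θE * (m * (1 + 2 / (kap - kap')) ^ ν)) :=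
    WRS_of_entrywise_loc (Kc := fun b : ℝ => (1 + 2 / b) ^ ν) kc_tdist1 hθE hlt 𝒦.locΛ hfib (h.dE σ hσ u hu)
  have e : 𝒦.C⁻¹.map (algebraMap ℝ ℂ) + (𝒦.A2 σ u - 𝒦.C⁻¹.map (algebraMap ℝ ℂ)) = 𝒦.A2 σ u := by abel
  refine ⟨?_, fun b b' => ?_⟩
  · have hu' := B13PerturbativeStep.isUnit_add hw hM hK hR hsmall
    rwa [e] at hu'
  · have key := (B13PerturbativeStep.WRS.inv_add hw hM hK hR hsmall).norm_apply_le b b'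
    rwa [e] at key

/-- The Γ-majorant by the triangle `G = Γ₀ + (G − Γ₀)`: `‖G(σ,u)(b,j)‖ ≤ (K_Γ + θ_Γ)e^{−κd₁}` ([folklore] triangle inequality; the
printed majorant [II] p.13 from the reference localisation p.15 and the difference (2.16)). [cite: Balaban1988RG2Cluster, p.13, p.15, (2.16) p.16] -/
theorem gamma_majorant (h : Kernel216R 𝒦 α kap KΓ K₀ θΓ θE) (σ : TPt d N' → ℂ) (hσ : ∀ j, ‖σ j‖ ≤ Real.exp c.κ₁)
    (u : E) (hu : ‖u‖ ≤ α) (b : 𝒦.Λ) (j : 𝒦.Λ ⊕ 𝒦.C₀) :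
    ‖𝒦.G2 σ u b j‖ ≤ (KΓ + θΓ) * Real.exp (-(kap * tdist1 Nf (𝒦.locΛ b) (𝒦.locN j))) := by
  have h2 : ‖(𝒦.Γ₀.map (algebraMap ℝ ℂ)) b j‖ = ‖𝒦.Γ₀ b j‖ := by
    rw [Matrix.map_apply, Complex.coe_algebraMap, Complex.norm_real]
  calc ‖𝒦.G2 σ u b j‖ = ‖(𝒦.G2 σ u - 𝒦.Γ₀.map (algebraMap ℝ ℂ)) b j + (𝒦.Γ₀.map (algebraMap ℝ ℂ)) b j‖ := by
        rw [Matrix.sub_apply, sub_add_cancel]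
    _ ≤ ‖(𝒦.G2 σ u - 𝒦.Γ₀.map (algebraMap ℝ ℂ)) b j‖ + ‖(𝒦.Γ₀.map (algebraMap ℝ ℂ)) b j‖ := norm_add_le _ _
    _ ≤ θΓ * Real.exp (-(kap * tdist1 Nf (𝒦.locΛ b) (𝒦.locN j)))
        + KΓ * Real.exp (-(kap * tdist1 Nf (𝒦.locΛ b) (𝒦.locN j))) :=
        add_le_add (h.dΓ σ hσ u hu b j) (by rw [h2]; exact h.refΓ b j)
    _ = (KΓ + θΓ) * Real.exp (-(kap * tdist1 Nf (𝒦.locΛ b) (𝒦.locN j))) := by ring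

/-- **(W-216R) ⟹ (W-216) AT A DROPPED RATE, IN NODE A'S SMALLNESS REGIME**: `Kernel216R 𝒦 α κ K_Γ K₀ θ_Γ θ_E`, signs, a fibre
bound `m ≥ 𝒦.m`, `0 ≤ κ′ < κ` and the Neumann smallness `K₀·mK_c(κ−κ′)·θ_E·mK_c(κ−κ′) < 1` give `Kernel216 𝒦 α κ′ (K_Γ + θ_Γ)
((1 − K₀mK_cθ_EmK_c)⁻¹K₀mK_c) θ_Γ θ_E`.  So in that regime the two records are EQUIVALENT up to letters (`Kernel216.toR` is the
converse): the uniform complex majorant ∕ walk expansion of the COVARIANCE is not an independent duty of NODE O's supplier.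
[cite: Balaban1988RG2Cluster, (2.16) p.16, p.13] -/
theorem toKernel216 (h : Kernel216R 𝒦 α kap KΓ K₀ θΓ θE) (hKΓ : 0 ≤ KΓ) (hK₀ : 0 ≤ K₀) (hθΓ : 0 ≤ θΓ) (hθE : 0 ≤ θE)
    {m : ℕ} (hm : 𝒦.m ≤ m) {kap' : ℝ} (hkap' : 0 ≤ kap') (hlt : kap' < kap)
    (hsmall : K₀ * (m * (1 + 2 / (kap - kap')) ^ ν) * (θE * (m * (1 + 2 / (kap - kap')) ^ ν)) < 1) :
    Kernel216 𝒦 α kap' (KΓ + θΓ)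
      ((1 - K₀ * (m * (1 + 2 / (kap - kap')) ^ ν) * (θE * (m * (1 + 2 / (kap - kap')) ^ ν)))⁻¹
        * (K₀ * (m * (1 + 2 / (kap - kap')) ^ ν))) θΓ θE := by
  have hex : ∀ a b : UT Nf, Real.exp (-(kap * tdist1 Nf a b)) ≤ Real.exp (-(kap' * tdist1 Nf a b)) := fun a b =>
    Real.exp_le_exp.2 (neg_le_neg (mul_le_mul_of_nonneg_right hlt.le (tdist1_nonneg _ _)))
  refine ⟨fun σ hσ u hu b j => (h.gamma_majorant σ hσ u hu b j).trans ?_,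
    fun σ hσ u hu b b' => (h.inv_majorant hK₀ hθE hm hkap' hlt hsmall σ hσ u hu).2 b b',
    fun σ hσ u hu b j => (h.dΓ σ hσ u hu b j).trans ?_, fun σ hσ u hu b b' => (h.dE σ hσ u hu b b').trans ?_,
    h.holE, h.holΓ⟩
  · exact mul_le_mul_of_nonneg_left (hex _ _) (add_nonneg hKΓ hθΓ)
  · exact mul_le_mul_of_nonneg_left (hex _ _) hθΓ
  · exact mul_le_mul_of_nonneg_left (hex _ _) hθE

end Kernel216R

/-- (W-covR, ONE TERM, WALK LEVEL) **NODE O's package WITHOUT THE COVARIANCE EXPANSION**: `TermWalkData 𝒦 w` with the field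
`hCov` (walk majorants of `A(σ,u)⁻¹` on the `w.R`-ball, constant `K̄_C`) REPLACED by the real reference localisation
`‖C(b,b′)‖ ≤ K₀e^{−w.κ d₁}` ([B9] Thm 3.10 at the real background — in print).  The joint walk expansions of the Γ-kernel and of the
PRECISION and the geometric clause stay. [cite: Balaban1988RG2Cluster, p.13, p.15; Balaban1985BackgroundPropagators, Thm 3.10 p.416] -/
structure TermWalkDataR (𝒦 : TermKernels c d N' ν Nf E) (w : WalkConsts) (K₀ : ℝ) : Prop where
  hΓ : ∃ (W : Type) (T : W → (TPt d N' → ℂ) → E → Matrix 𝒦.Λ (𝒦.Λ ⊕ 𝒦.C₀) ℂ) (SX : Set W) (A : W → ℝ)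
      (D : W → UT Nf → UT Nf → ℝ) (ρ : ℝ), JointWalkExpansion c 𝒦.locΛ 𝒦.locN 𝒦.G2 𝒦.X w.R w.ε w.kap w.KbarΓ T SX A D ρ
  hE : ∃ (W : Type) (T : W → (TPt d N' → ℂ) → E → Matrix 𝒦.Λ 𝒦.Λ ℂ) (SX : Set W) (A : W → ℝ)
      (D : W → UT Nf → UT Nf → ℝ) (ρ : ℝ), JointWalkExpansion c 𝒦.locΛ 𝒦.locΛ 𝒦.A2 𝒦.X w.R w.ε w.kap w.KbarE T SX A D ρ
  refC : ∀ b b', ‖𝒦.C b b'‖ ≤ K₀ * Real.exp (-(w.kap * tdist1 Nf (𝒦.locΛ b) (𝒦.locΛ b')))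
  hfar : ∀ b : 𝒦.Λ, ∀ z ∈ 𝒦.X, w.Rσ ≤ tdist1 Nf (𝒦.locΛ b) z

/-- `TermWalkData ⟹ TermWalkDataR` with `K₀ := K̄_C` (the covariance majorant at `(0,0)` through `A(0,0)⁻¹ = C`; `0 ≤ α < w.R`).
[cite: Balaban1988RG2Cluster, p.15] -/
theorem TermWalkData.toR {𝒦 : TermKernels c d N' ν Nf E} {w : WalkConsts} {α Rσ₀ : ℝ} (hw : w.Admissible α Rσ₀)
    (hα : 0 ≤ α) (h : TermWalkData 𝒦 w) : TermWalkDataR 𝒦 w w.KbarC := by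
  obtain ⟨WC, TC, AC, DC, ρC, hC⟩ := h.hCov
  have h0 : ∀ j, ‖(0 : TPt d N' → ℂ) j‖ ≤ Real.exp c.κ₁ := fun _ => by
    rw [Pi.zero_apply, norm_zero]; exact (Real.exp_pos _).le
  have h00 : (0 : E) ∈ ball (0 : E) w.R := mem_ball_self (hα.trans_lt hw.hαR)
  refine ⟨h.hΓ, h.hE, fun b b' => ?_, h.hfar⟩
  have h1 := hC.majorants 0 h0 0 h00 b b'
  rwa [𝒦.hC0, Matrix.map_apply, Complex.coe_algebraMap, Complex.norm_real] at h1

/-- **(W-covR) ⟹ (W-216R)**: the package without covariance expansion gives the four-primitive record, letters `κ = w.κ`,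
`K_Γ = K̄_Γ`, `K₀`, `θ_Γ = 2K̄_Γe^{−εR_σ} + 2K̄_Γα/R`, `θ_E = 2K̄_Ee^{−εR_σ} + 2K̄_Eα/R` (the lines of SK `Kernel216.of_termWalkData`
:2618 minus the `hCov` line: `majorants` at `(0,0)`, `sub_ref_sigma` through `G(0,0) = Γ₀`, `A(0,0) = C⁻¹`, the Schwarz step
`sub_ref_le_of_analytic`, `analyticOnBall` restricted). [cite: Balaban1988RG2Cluster, (2.16) p.16, p.15, p.13; Balaban1985BackgroundPropagators, Thm 3.10 p.416] -/
theorem Kernel216R.of_termWalkDataR {𝒦 : TermKernels c d N' ν Nf E} {w : WalkConsts} {α Rσ₀ K₀ : ℝ}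
    (hw : w.Admissible α Rσ₀) (hα : 0 ≤ α) (h : TermWalkDataR 𝒦 w K₀) :
    Kernel216R 𝒦 α w.kap w.KbarΓ K₀
      (2 * w.KbarΓ * Real.exp (-(w.ε * w.Rσ)) + 2 * w.KbarΓ * α / w.R)
      (2 * w.KbarE * Real.exp (-(w.ε * w.Rσ)) + 2 * w.KbarE * α / w.R) := by
  obtain ⟨WΓ, TΓ, SXΓ, AΓ, DΓ, ρΓ, hΓ⟩ := h.hΓ
  obtain ⟨WE, TE, SXE, AE, DE, ρE, hE⟩ := h.hE
  have hR : 0 < w.R := hα.trans_lt hw.hαR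
  have h0 : ∀ j, ‖(0 : TPt d N' → ℂ) j‖ ≤ Real.exp c.κ₁ := fun _ => by
    rw [Pi.zero_apply, norm_zero]; exact (Real.exp_pos _).le
  have h00 : (0 : E) ∈ ball (0 : E) w.R := mem_ball_self hR
  -- the reference precision identity `A(0,0) = C⁻¹`
  have hE0 : 𝒦.A2 0 0 = 𝒦.C⁻¹.map (algebraMap ℝ ℂ) := by
    have hCu : IsUnit 𝒦.C.det := 𝒦.hC.det_pos.ne'.isUnit
    have hmul : 𝒦.C⁻¹.map (algebraMap ℝ ℂ) * 𝒦.C.map (algebraMap ℝ ℂ) = 1 := by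
      rw [← Matrix.map_mul, Matrix.nonsing_inv_mul 𝒦.C hCu, Matrix.map_one _ (map_zero _) (map_one _)]
    have hCmu : IsUnit (𝒦.C.map (algebraMap ℝ ℂ)) :=
      (Matrix.isUnit_iff_isUnit_det _).2 (Matrix.isUnit_det_of_left_inverse hmul)
    have hAu : IsUnit (𝒦.A2 0 0).det := by
      rw [← Matrix.isUnit_iff_isUnit_det, ← Matrix.isUnit_nonsing_inv_iff, 𝒦.hC0]; exact hCmu
    rw [← Matrix.nonsing_inv_nonsing_inv (𝒦.A2 0 0) hAu, 𝒦.hC0]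
    exact Matrix.inv_eq_left_inv hmul
  refine ⟨fun b j => ?_, h.refC, ?_, ?_,
    fun σ hσ b b' => (hE.analyticOnBall hw.hε σ hσ b b').mono (ball_subset_ball hw.hαR.le),
    fun σ hσ b j => (hΓ.analyticOnBall hw.hε σ hσ b j).mono (ball_subset_ball hw.hαR.le)⟩
  · have h1 := hΓ.majorants hw.hε 0 h0 0 h00 b j
    rwa [𝒦.hG0, Matrix.map_apply, Complex.coe_algebraMap, Complex.norm_real] at h1
  · intro σ hσ u hu b j
    have hσ' : ∀ b j, ‖(𝒦.G2 σ 0 - 𝒦.Γ₀.map (algebraMap ℝ ℂ)) b j‖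
        ≤ 2 * w.KbarΓ * Real.exp (-(w.ε * w.Rσ)) * Real.exp (-(w.kap * tdist1 Nf (𝒦.locΛ b) (𝒦.locN j))) := by
      rw [← 𝒦.hG0]; exact hΓ.sub_ref_sigma hR hw.hε h.hfar σ hσ
    exact B13PrimitiveKernels216.sub_ref_le_of_analytic (K := 𝒦.G2 σ) hR hw.hKbarΓ hw.hαR
      (fun b j => (Real.exp_pos _).le) hσ' (hΓ.analyticOnBall hw.hε σ hσ) (hΓ.majorants hw.hε σ hσ) hu b j
  · intro σ hσ u hu b b'
    have hσ' : ∀ b b', ‖(𝒦.A2 σ 0 - 𝒦.C⁻¹.map (algebraMap ℝ ℂ)) b b'‖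
        ≤ 2 * w.KbarE * Real.exp (-(w.ε * w.Rσ)) * Real.exp (-(w.kap * tdist1 Nf (𝒦.locΛ b) (𝒦.locΛ b'))) := by
      rw [← hE0]; exact hE.sub_ref_sigma hR hw.hε h.hfar σ hσ
    exact B13PrimitiveKernels216.sub_ref_le_of_analytic (K := 𝒦.A2 σ) hR hw.hKbarE hw.hαR
      (fun b b' => (Real.exp_pos _).le) hσ' (hE.analyticOnBall hw.hε σ hσ) (hE.majorants hw.hε σ hσ) hu b b'

end FourPrimitives

/-! ## §4  (W-216R|P) on a member set, and (W-216R|P) ⟹ (W-216|P) under a uniform ENTROPY letter and the Neumann smallness -/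

section Family

variable {d : ℕ} {c : B13.Consts}

/-- (W-216R|P) **NODE O WITHOUT WALKS AND WITHOUT COVARIANCE ∕ Γ MAJORANTS ON A MEMBER SET `P`**: common letters `κ > 0`,
`K_Γ, K₀ ≥ 0`, `0 ≤ θ_Γ, θ_E ≤ θ₀` such that every term of every member of `P` satisfies `Kernel216R` — two real reference
localisations + two (2.16)-differences + u-holomorphy, uniformly. [cite: Balaban1988RG2Cluster, (2.16) p.16, p.15] -/
def AcrossOn216R {S : Type*} (𝓣 : S → TorusTerms c d) (P : Set S) (α θ₀ : ℝ) : Prop :=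
  ∃ kap KΓ K₀ θΓ θE : ℝ, 0 < kap ∧ 0 ≤ KΓ ∧ 0 ≤ K₀ ∧ 0 ≤ θΓ ∧ 0 ≤ θE ∧ θΓ ≤ θ₀ ∧ θE ≤ θ₀ ∧
    ∀ s ∈ P, ∀ i : (𝓣 s).ι, Kernel216R ((𝓣 s).𝒦 i) α kap KΓ K₀ θΓ θE

/-- (W-216|P) ⟹ (W-216R|P), letters kept. [cite: Balaban1988RG2Cluster, p.15] -/
theorem acrossOn216R_of_acrossOn216 {S : Type*} {𝓣 : S → TorusTerms c d} {P : Set S} {α θ₀ : ℝ} (hα : 0 ≤ α)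
    (h : AcrossOn216 𝓣 P α θ₀) : AcrossOn216R 𝓣 P α θ₀ := by
  obtain ⟨kap, KG, KCs, θΓ, θE, h1, h2, h3, h4, h5, h6, h7, hall⟩ := h
  exact ⟨kap, KG, KCs, θΓ, θE, h1, h2, h3, h4, h5, h6, h7, fun s hs i => (hall s hs i).toR hα⟩

/-- The Neumann covariance constant `x ↦ (1 − K₀xθ_Ex)⁻¹K₀x` is monotone on `0 ≤ x ≤ Λ` when `K₀Λθ_EΛ < 1` ([folklore] real arithmetic; the
entropy letter `Λ` bounds `m(1+2∕(κ−κ′))^ν`, [II] (1.11) p.5 ∕ (2.26) p.17). [cite: Balaban1988RG2Cluster, (2.26) p.17, (1.11) p.5] -/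
theorem neumann_const_mono {K₀ θE x Λ : ℝ} (hK₀ : 0 ≤ K₀) (hθE : 0 ≤ θE) (hx : 0 ≤ x) (hxΛ : x ≤ Λ)
    (hsmall : K₀ * Λ * (θE * Λ) < 1) :
    K₀ * x * (θE * x) < 1 ∧ (1 - K₀ * x * (θE * x))⁻¹ * (K₀ * x) ≤ (1 - K₀ * Λ * (θE * Λ))⁻¹ * (K₀ * Λ) := by
  have hΛ : 0 ≤ Λ := hx.trans hxΛ
  have hle : K₀ * x * (θE * x) ≤ K₀ * Λ * (θE * Λ) := by gcongr
  refine ⟨hle.trans_lt hsmall, mul_le_mul ?_ (by gcongr) (by positivity) (inv_nonneg.2 (sub_nonneg.2 hsmall.le))⟩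
  exact inv_anti₀ (sub_pos.2 hsmall) (sub_le_sub_left hle 1)

/-- **(W-216R|P) ⟹ (W-216|P) IN NODE A'S REGIME** (letters explicit): four-primitive records with common letters on `P`, a drop
`0 < κ′ < κ`, a UNIFORM ENTROPY LETTER `Λ₀ ≥ m_{s,i}·(1+2∕(κ−κ′))^{ν_s}` (per-term fibre bound `m`, per-member torus dimension
`ν` — both typed per member in `TorusTerms`; for Bałaban's family `ν = d` and `m` is a lattice constant) and the Neumann
smallness `K₀Λ₀·θ_EΛ₀ < 1` give (W-216|P) with letters `(κ′, K_Γ + θ_Γ, (1 − K₀Λ₀θ_EΛ₀)⁻¹K₀Λ₀, θ_Γ, θ_E)` — hence NODE A's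
inputs (SK `AcrossOn216.nodeA_inputs` :2715) and the spine (§2) exactly as from (W-216|P).  The entropy letter is where the
(2.16)-level smallness meets the per-member geometry: NODE A's own numerics (T21 `hθR1le hsmallKθ hvol`) carry the same factors
per term. [cite: Balaban1988RG2Cluster, (2.16) p.16, p.13, (1.11) p.5] -/
theorem acrossOn216_of_R {S : Type*} {𝓣 : S → TorusTerms c d} {P : Set S} {α θ₀ kap KΓ K₀ θΓ θE Λ₀ : ℝ}
    (hKΓ : 0 ≤ KΓ) (hK₀ : 0 ≤ K₀) (hθΓ : 0 ≤ θΓ) (hθE : 0 ≤ θE) (h1 : θΓ ≤ θ₀) (h2 : θE ≤ θ₀)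
    (hall : ∀ s ∈ P, ∀ i : (𝓣 s).ι, Kernel216R ((𝓣 s).𝒦 i) α kap KΓ K₀ θΓ θE)
    {kap' : ℝ} (hkap' : 0 < kap') (hlt : kap' < kap)
    (hent : ∀ s ∈ P, ∀ i : (𝓣 s).ι, (((𝓣 s).𝒦 i).m : ℝ) * (1 + 2 / (kap - kap')) ^ (𝓣 s).ν ≤ Λ₀)
    (hΛ : 0 ≤ Λ₀) (hsmall : K₀ * Λ₀ * (θE * Λ₀) < 1) :
    AcrossOn216 𝓣 P α θ₀ := by
  refine ⟨kap', KΓ + θΓ, (1 - K₀ * Λ₀ * (θE * Λ₀))⁻¹ * (K₀ * Λ₀), θΓ, θE, hkap', add_nonneg hKΓ hθΓ,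
    mul_nonneg (inv_nonneg.2 (sub_nonneg.2 hsmall.le)) (mul_nonneg hK₀ hΛ), hθΓ, hθE, h1, h2, fun s hs i => ?_⟩
  have hx : 0 ≤ (((𝓣 s).𝒦 i).m : ℝ) * (1 + 2 / (kap - kap')) ^ (𝓣 s).ν := by
    have : 0 < kap - kap' := sub_pos.2 hlt
    positivity
  obtain ⟨hsm, hle⟩ := neumann_const_mono hK₀ hθE hx (hent s hs i) hsmall
  exact ((hall s hs i).toKernel216 hKΓ hK₀ hθΓ hθE le_rfl hkap'.le hlt hsm).weaken (add_nonneg hKΓ hθΓ)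
    (mul_nonneg (inv_nonneg.2 (sub_nonneg.2 hsm.le)) (mul_nonneg hK₀ hx)) hθΓ hθE le_rfl le_rfl hle le_rfl le_rfl

end Family

end Literature.MathematicalPhysics.QuantumFieldTheory.Balaban1983to89.NodeOKernel216R

end
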